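import Summits.ValiantsHypothesis.ValiantsHypothesis.Theses.NewtonUnitEquations
import Summits.ValiantsHypothesis.ValiantsHypothesis.Theorems.SoloBlindNewtonRungs

/-!
# Crux `TwoProducts` (stmt-ValiantsHypothesis-5906) — idea `presentation-bootstrap` PORTED (val-idea-35's sorry-free sketch
# `pub/ideators/val-idea-35/PresentationBootstrap.lean` rev 3, sha16 bb1b1633d2042f36, VERBATIM; namespace `Cruxes.… → Theorems.…`,
# one lint fix `push_neg → push Not`; porter val-port-1 g2, val-lit port pool, desk g13 RULING #310 (C); part 1/2 —
# part 2 = `…NewtonUnitEquationsTwoProductsPresentationBootstrapRegime` (split only because Theorems proof files are ≤ 400 lines))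
SCOPE LABEL: **reformulation + refutation criterion; closes nothing.**  The crux bound `2^(a m)·(t+2)^b` is NOT invariant under
re-blocking (`M` factors of sparsity `s` ↦ `⌈M/r⌉` blocks of sparsity `≤ s^r`), so the crux is SELF-IMPROVING:
`blockBound_of_twoProducts` (same bound for every block presentation), `boundedSparsitySubexp_of_twoProducts` (fixed sparsity `s`
⇒ `≤ 2^(C_s(√M+1))` vertices), `not_twoProducts_of_trinomialExpGrowth` (exponential vertex growth for two products of `M` TRINOMIALS
refutes the crux BY NAME — the card's refutation criterion), `polyInExpRegime_of_twoProducts` / `twoProducts_of_polyInExpRegime`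
(the crux ⟺ the polynomial bound `#vert ≤ (t+2)^b` in the regime `t ≥ 2^(κ m)`).  Helper (`--supports stmt-ValiantsHypothesis-5906
--as helper`); nothing here proves or refutes `TwoProducts` (5906 OPEN); VP ≠ VNP is NOT proved.
-/

set_option linter.dupNamespace false

namespace Summit.ValiantsHypothesis.ValiantsHypothesis.Theorems.NewtonUnitEquations.TwoProducts.PresentationBootstrap

open scoped BigOperators Pointwise
open Summit.ValiantsHypothesis.ValiantsHypothesis.Theses.NewtonUnitEquations (TwoProducts)

/-- number of vertices of the Newton polygon of `W` (the crux's count, verbatim). -/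
noncomputable abbrev vert (W : MvPolynomial (Fin 2) ℂ) : ℕ :=
  (Set.extremePoints ℝ (convexHull ℝ ((fun e : Fin 2 →₀ ℕ => fun i : Fin 2 => ((e i : ℕ) : ℝ)) ''
    (W.support : Set (Fin 2 →₀ ℕ))))).ncard

/-- A finite product of `s`-sparse polynomials has at most `s ^ #S` monomials. -/
theorem card_support_prod_le {ι : Type*} [DecidableEq ι] (S : Finset ι) (s : ℕ)
    (f : ι → MvPolynomial (Fin 2) ℂ) (hf : ∀ i ∈ S, (f i).support.card ≤ s) :
    (∏ i ∈ S, f i).support.card ≤ s ^ S.card := by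
  classical
  induction S using Finset.induction_on with
  | empty =>
    simp only [Finset.prod_empty, Finset.card_empty, pow_zero]
    rw [← MvPolynomial.C_1, MvPolynomial.C_apply]
    exact (Finset.card_le_card MvPolynomial.support_monomial_subset).trans (by simp)
  | insert a S ha ih =>
    rw [Finset.prod_insert ha, Finset.card_insert_of_notMem ha, pow_succ]
    calc ((f a) * ∏ i ∈ S, f i).support.card
        ≤ ((f a).support + (∏ i ∈ S, f i).support).card :=
          Finset.card_le_card (MvPolynomial.support_mul _ _)
      _ ≤ (f a).support.card * (∏ i ∈ S, f i).support.card := Finset.card_add_le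
      _ ≤ s * s ^ S.card :=
          Nat.mul_le_mul (hf a (by simp)) (ih (fun i hi => hf i (by simp [hi])))
      _ = s ^ S.card * s := by ring

/-- Re-blocking a product over `Fin (k * r)` into `k` blocks of `r` consecutive factors. -/
theorem prod_blocks (k r : ℕ) (f : Fin (k * r) → MvPolynomial (Fin 2) ℂ) :
    ∏ j : Fin k, ∏ i : Fin r, f (finProdFinEquiv (j, i)) = ∏ i, f i := by
  have h1 : ∏ x : Fin k × Fin r, f (finProdFinEquiv x) =
      ∏ j : Fin k, ∏ i : Fin r, f (finProdFinEquiv (j, i)) := Fintype.prod_prod_type _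
  rw [← h1]
  exact Fintype.prod_equiv finProdFinEquiv _ _ (fun _ => rfl)

/-- The crux's bound transported to BLOCK presentations: `k` blocks of `r` factors of sparsity `≤ s`
(so each block is a factor of sparsity `≤ s^r`). -/
def BlockBound : Prop :=
  ∃ a b : ℕ, ∀ (k r s : ℕ) (f g : Fin (k * r) → MvPolynomial (Fin 2) ℂ),
    (∀ i, (f i).support.card ≤ s) → (∀ i, (g i).support.card ≤ s) →
      vert (∏ i, f i - ∏ i, g i) ≤ 2 ^ (a * k) * (s ^ r + 2) ^ b

/-- FIRST LEMMA (proved): `TwoProducts` is inherited by every block presentation, with the SAME `(a, b)`. -/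
theorem blockBound_of_twoProducts (h : TwoProducts) : BlockBound := by
  obtain ⟨a, b, hab⟩ := h
  refine ⟨a, b, fun k r s f g hf hg => ?_⟩
  have hF : ∀ j : Fin k, (∏ i : Fin r, f (finProdFinEquiv (j, i))).support.card ≤ s ^ r := fun j => by
    simpa using card_support_prod_le (Finset.univ : Finset (Fin r)) s
      (fun i => f (finProdFinEquiv (j, i))) (fun i _ => hf _)
  have hG : ∀ j : Fin k, (∏ i : Fin r, g (finProdFinEquiv (j, i))).support.card ≤ s ^ r := fun j => by
    simpa using card_support_prod_le (Finset.univ : Finset (Fin r)) s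
      (fun i => g (finProdFinEquiv (j, i))) (fun i _ => hg _)
  have key := hab k (s ^ r) (fun j => ∏ i : Fin r, f (finProdFinEquiv (j, i)))
    (fun j => ∏ i : Fin r, g (finProdFinEquiv (j, i))) hF hG
  simpa only [prod_blocks] using key

/-- Bounded sparsity forces SUBEXPONENTIAL growth in the number of factors (corollary of `BlockBound` by
optimising the block size `r ≈ √(aM / (b log s))`): for each `s` a constant `C` with `#vert ≤ 2^(C (√M + 1))`. -/
def BoundedSparsitySubexp : Prop :=
  ∀ s : ℕ, ∃ C : ℕ, ∀ (M : ℕ) (f g : Fin M → MvPolynomial (Fin 2) ℂ),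
    (∀ i, (f i).support.card ≤ s) → (∀ i, (g i).support.card ≤ s) →
      vert (∏ i, f i - ∏ i, g i) ≤ 2 ^ (C * (Nat.sqrt M + 1))

-- `boundedSparsitySubexp_of_twoProducts` is proved at the end of the file (it needs the padding helpers).

/-- REFUTATION TARGET: two products of `M` TRINOMIALS with exponentially many Newton vertices
(`> 2^(M/c)` for unboundedly many `M`). -/
def TrinomialExpGrowth : Prop :=
  ∃ c : ℕ, 0 < c ∧ ∀ M₀ : ℕ, ∃ M : ℕ, M₀ ≤ M ∧ ∃ f g : Fin M → MvPolynomial (Fin 2) ℂ,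
    (∀ i, (f i).support.card ≤ 3) ∧ (∀ i, (g i).support.card ≤ 3) ∧
      2 ^ (M / c) < vert (∏ i, f i - ∏ i, g i)

/-- Padding a family of `M` factors to `N ≥ M` factors by `1`s. -/
noncomputable def pad {M : ℕ} (f : Fin M → MvPolynomial (Fin 2) ℂ) (N : ℕ) : Fin N → MvPolynomial (Fin 2) ℂ :=
  fun i => if h : (i : ℕ) < M then f ⟨i, h⟩ else 1

/-- Padding a factor family with `1`s does not change the product. -/
theorem prod_pad {M N : ℕ} (hMN : M ≤ N) (f : Fin M → MvPolynomial (Fin 2) ℂ) :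
    ∏ i : Fin N, pad f N i = ∏ i, f i := by
  classical
  let F : ℕ → MvPolynomial (Fin 2) ℂ := fun n => if h : n < M then f ⟨n, h⟩ else 1
  have hL : ∏ i : Fin N, pad f N i = ∏ n ∈ Finset.range N, F n := by
    rw [← Fin.prod_univ_eq_prod_range]
    rfl
  have hR : ∏ i : Fin M, f i = ∏ n ∈ Finset.range M, F n := by
    rw [← Fin.prod_univ_eq_prod_range]
    refine Finset.prod_congr rfl (fun i _ => ?_)
    simp [F, i.2]
  rw [hL, hR]
  symm
  apply Finset.prod_subset (Finset.range_mono hMN)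
  intro x _ hx
  have hx' : ¬ x < M := by simpa using hx
  simp [F, hx']

/-- Padded families stay `s`-sparse (`s ≥ 1`). -/
theorem card_support_pad_le {M s : ℕ} (hs : 1 ≤ s) (f : Fin M → MvPolynomial (Fin 2) ℂ)
    (hf : ∀ i, (f i).support.card ≤ s) (N : ℕ) : ∀ i, (pad f N i).support.card ≤ s := by
  intro i
  unfold pad
  split_ifs with h
  · exact hf _
  · exact card_support_one_le.trans hs

/-- The arithmetic of the block choice `r = 2ac + 1`, `k = M/r + 1`, `s = 3`. -/
theorem block_arith (a b c M r : ℕ) (hc : 0 < c) (hr : r = 2 * a * c + 1)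
    (hM : 2 * c * (a + (2 * r + 1) * b + 1) ≤ M) :
    2 ^ (a * (M / r + 1)) * (3 ^ r + 2) ^ b ≤ 2 ^ (M / c) := by
  have hrpos : 0 < r := by omega
  have h32 : 3 ^ r + 2 ≤ 2 ^ (2 * r + 1) := by
    have h1 : 3 ^ r ≤ 4 ^ r := Nat.pow_le_pow_left (by norm_num) r
    have h2 : (4 : ℕ) ^ r = 2 ^ (2 * r) := by
      rw [pow_mul]; norm_num
    have h3 : 2 ≤ 2 ^ (2 * r) := by
      calc (2 : ℕ) = 2 ^ 1 := by norm_num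
        _ ≤ 2 ^ (2 * r) := Nat.pow_le_pow_right (by norm_num) (by omega)
    have h4 : (2 : ℕ) ^ (2 * r + 1) = 2 ^ (2 * r) + 2 ^ (2 * r) := by rw [pow_succ]; ring
    rw [h4]; omega
  have hb : (3 ^ r + 2) ^ b ≤ 2 ^ ((2 * r + 1) * b) := by
    rw [pow_mul]; exact Nat.pow_le_pow_left h32 b
  have hdiv : a * (M / r + 1) ≤ M / (2 * c) + a := by
    rcases Nat.eq_zero_or_pos a with ha | ha
    · simp [ha]
    · have h5 : a * (M / r) ≤ M / (2 * c) := by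
        calc a * (M / r) ≤ a * M / r := Nat.mul_div_le_mul_div_assoc _ _ _
          _ ≤ a * M / (2 * a * c) := Nat.div_le_div_left (by omega) (by positivity)
          _ = a * M / (a * (2 * c)) := by rw [show 2 * a * c = a * (2 * c) by ring]
          _ = M / (2 * c) := Nat.mul_div_mul_left M (2 * c) ha
      calc a * (M / r + 1) = a * (M / r) + a := by ring
        _ ≤ M / (2 * c) + a := by omega
  have hM2 : a + (2 * r + 1) * b + 1 ≤ M / (2 * c) := by
    rw [Nat.le_div_iff_mul_le (by positivity)]
    calc (a + (2 * r + 1) * b + 1) * (2 * c) = 2 * c * (a + (2 * r + 1) * b + 1) := by ring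
      _ ≤ M := hM
  have hM3 : M / (2 * c) + M / (2 * c) ≤ M / c := by
    have h6 : M / (2 * c) = M / c / 2 := by rw [Nat.div_div_eq_div_mul, mul_comm]
    rw [h6]; omega
  calc 2 ^ (a * (M / r + 1)) * (3 ^ r + 2) ^ b
      ≤ 2 ^ (a * (M / r + 1)) * 2 ^ ((2 * r + 1) * b) := Nat.mul_le_mul_left _ hb
    _ = 2 ^ (a * (M / r + 1) + (2 * r + 1) * b) := (pow_add _ _ _).symm
    _ ≤ 2 ^ (M / c) := Nat.pow_le_pow_right (by norm_num) (by
        have h7 : a * (M / r + 1) + (2 * r + 1) * b ≤ M / (2 * c) + a + (2 * r + 1) * b :=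
          Nat.add_le_add_right hdiv _
        omega)

/-- Exponential trinomial growth refutes the crux: pad `M` to `(M/r + 1)·r` factors with `1`s
(`r = 2ac+1`), apply `BlockBound` with `k = M/r + 1`, `s = 3`, and compare with `block_arith`. -/
theorem not_twoProducts_of_trinomialExpGrowth : TrinomialExpGrowth → ¬ TwoProducts := by
  rintro ⟨c, hc, hgrow⟩ hTP
  obtain ⟨a, b, hab⟩ := blockBound_of_twoProducts hTP
  obtain ⟨M, hM, f, g, hf, hg, hlt⟩ := hgrow (2 * c * (a + (2 * (2 * a * c + 1) + 1) * b + 1))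
  set r : ℕ := 2 * a * c + 1 with hr
  have hrpos : 0 < r := by omega
  have hMN : M ≤ (M / r + 1) * r := by
    have h := Nat.lt_div_mul_add (a := M) hrpos
    rw [add_mul, one_mul]
    exact h.le
  have key := hab (M / r + 1) r 3 (pad f _) (pad g _)
    (card_support_pad_le (by norm_num) f hf _) (card_support_pad_le (by norm_num) g hg _)
  rw [prod_pad hMN, prod_pad hMN] at key
  have harith := block_arith a b c M r hc hr hM
  exact absurd (hlt.trans_le (key.trans harith)) (lt_irrefl _)

end Summit.ValiantsHypothesis.ValiantsHypothesis.Theorems.NewtonUnitEquations.TwoProducts.PresentationBootstrap
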